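import Literature.Geometry.Kaehler.ComplexTorusPicardNumberPoincareLength
import HarnessLib

/-!
# Hulek–Laface 2019, Thm. 1.1 (2) (the second gap `(g−2)² + 4 < ρ < (g−1)² + 1`), Thm. 4.1 and Thm. 4.2
# (abelian varieties with `ρ = g²`, `(g−1)² + 1`, `(g−2)² + 4`), outside the cases that need Murty's bound

Layer `Literature/Geometry/Kaehler`, namespace `Literature.Geometry.Kaehler.ComplexTorus`; lane
`lit-hodgefound` (Track 2 foundations library), Layer A4 row A4-13 (self-proposed 2026-08-22, seat
`lit-hodgefound-p18`, generation 6, row g6-#2). Direct sequel of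
`ComplexTorusPicardNumberPoincareLength.lean` (this seat, g6-#1): there an abelian variety `A` is followed
along a POINCARÉ DECOMPOSITION `A ∼ ∏_ν X_ν^{n_ν} = ComplexTorus (sigmaPiPeriod fun ν ↦ powPeriod (X ν) (n ν))`
(simple, nonzero, pairwise non-isogenous abelian varieties `X_ν`, `n_ν ≥ 1`; it exists and its length
`r = r(A)` is unique by seat p10's `poincare_complete_reducibility_powers` / `card_eq_of_isIsogenous_powers`),
with Cor. 2.3 as printed (`finrank_neronSeveriGroup_powers`), Prop. 3.1 (`ρ(A) ≤ M_{r(A),g}`,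
`IsIsogenous.finrank_neronSeveriGroup_le_of_powers`), Cor. 3.2 (`IsIsogenous.finrank_neronSeveriGroup_eq_iff_of_powers`)
and Thm. 1.1 (1).  Here the remaining statements of §3.3 and §4 are proved for every abelian variety whose
Poincaré decomposition avoids the cases the paper settles with MURTY's bound `ρ(Bᵏ) ≤ ½ nk(2k+1)`
(Prop. 2.4 / Cor. 2.5, Murty 1984 — not in the tree): the hypothesis "if `r(A) ≤ 2` then every simple
factor `X_ν` is an elliptic curve" (for Thm. 4.2 (1) only "if `r(A) = 1` …") is carried explicitly.

Source followed, verbatim (K. Hulek, R. Laface, *On the Picard numbers of abelian varieties*, Ann. Sc.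
Norm. Super. Pisa Cl. Sci. (5) XIX (2019); held text `paper:arxiv-1703.05882` p0002, p0007–p0009):
"**Theorem 1.1.** (2) Fix `g ≥ 7`. There does not exist any abelian variety of dimension `g` with Picard
number `ρ` in the following range: `(g−2)² + 4 < ρ < (g−1)² + 1`." — §3.3: "To start with observe that, if
`r(A) ≥ 3`, then `ρ(A) ≤ M_{r(A),g} ≤ M_{3,g} < (g−2)² + 4`. Therefore, we can assume `r(A) ≤ 2`. Suppose
that `A` is an abelian variety with `r(A) = 1`, i.e. `A ∼ B^k` with `dim B = b` and `bk = g`. If `b = 1`,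
then `B` is an elliptic curve […] If `B` does have complex multiplication, then `ρ(A) = g²` (the maximal
Picard number), otherwise `ρ(A) = ½ g(g+1) < (g−2)² + 4` (as `g ≥ 7`). If `b > 1` [… Corollary 2.5 …].
**Step 1** We deal with abelian varieties of the form `E_1^n × E_2^{g−n}` […] If `n = 1`, then
`ρ(E_1 × E_2^{g−1}) = 1 + ρ(E_2^{g−1})` which equals `M_{2,g}` if `E_2` has complex multiplication, and
`1 + ½ g(g−1)` otherwise […] Suppose now that `n ≥ 2`: we have that `ρ(E_1^n × E_2^{g−n}) ≤ n² + (g−n)²`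
[…] `f(2) = f(g−2) = (g−2)² + 4`. **Step 2** [`E^k × A^l`, Lemma 2.5] **Step 3** [`A^k × B^l`, Cor. 2.5]."
— "**Theorem 4.2.** Let `A` be an abelian variety of dimension `g`. Suppose `g ≥ 5`. Then,
`ρ(A) = (g−1)² + 1 ⟺ A ∼ E_1^{g−1} × E_2`, where `E_1` has complex multiplication and `E_1` and `E_2`
are not isogeneous. Suppose `g ≥ 7`. Then, `ρ(A) = (g−2)² + 4 ⟺ A ∼ E_1^{g−2} × E_2²`, where `E_1` and
`E_2` both have complex multiplication but are not isogeneous. *Proof.* […] By definition of `M_{r,g}` it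
follows that `r(A) ≤ 2`; we claim that `r(A) = 2`. Indeed, if `r(A) = 1`, then necessarily `A ∼ E^g`. But
then either `ρ(A) = g²` […] or `ρ(A) = C(g+1, 2)` otherwise, either of which is a contradiction. Therefore
`r(A) = 2` and (1) follows from Corollary 3.2. […] (c) Let `A ∼ E_1^n × E_2^{g−n}` […] the cases `n = 1`
and `n = g−1` can be discarded […] if one of the factors does not have complex multiplication then
`ρ(A) ≤ 3 + (g−2)² < 4 + (g−2)²`. Therefore both `E_1` and `E_2` must have complex multiplication, and
so `ρ(A) = n² + (g−n)²`. The maximum of this expression is achieved for `n = 2` or `n = g−2`".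

## Contents (theorems only; no definition, no named fact, net debt 0)

* §1 the printed inequalities: `choose_succ_two_add_one_le_sq`
  (`C(a+1,2) + 1 ≤ a²`, `a ≥ 2`), `choose_succ_two_lt_sq_sub_two_add_four` (`C(g+1,2) < (g−2)²+4`, `g ≥ 7`),
  `one_add_choose_two_lt_sq_sub_two_add_four` (`1 + C(g,2) < (g−2)²+4`), `sq_sub_two_add_four_lt_sq_pred_add_one`,
  `sq_pred_add_one_le_sq`, `sq_add_sq_le_sq_sub_two_add_four` (`a²+b² ≤ (a+b−2)²+4`, `a, b ≥ 2`) with the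
  equality case `eq_two_or_eq_two_of_sq_add_sq_eq`, `choose_succ_two_lt_sq_pred_add_one` (`g ≥ 5`; for
  `g = 4`, `C(5,2) = 10 = 3² + 1` — the reason for "`g ≥ 5`"), `sq_sub_add_le_sq_sub_two_add_two`
  (`M_{r,g} ≤ M_{3,g}`, `r ≥ 3`); Step 1 as arithmetic **`not_lt_add_lt_of_pow_dichotomy`** and Thm. 4.2
  (2)(c) as arithmetic **`eq_sq_of_add_eq_sq_sub_two_add_four`**.
* §2 `ρ(Eᵏ)` for an ABSTRACT one-dimensional torus `E` (every such torus is some `E_θ`,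
  `exists_isIsomorphic_ellipticPeriod`): `exists_isIsomorphic_ellipticPeriod_forall_ne`,
  **`finrank_neronSeveriGroup_pow_of_cm`** (`= k²`), **`finrank_neronSeveriGroup_pow_of_not_cm`**
  (`= C(k+1,2)`, seat p17's `IsIsogenous.finrank_neronSeveriGroup_eq_choose_of_forall_ne`),
  `finrank_neronSeveriGroup_pow_eq_sq_or_eq_choose` (Cor. 2.6), `finrank_endAlgRat_eq_two_of_pow_eq_sq`.
* §3 short decompositions: `finrank_neronSeveriGroup_powers_of_univ_eq_pair`, `finrank_powers_of_univ_eq_pair`,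
  **`IsIsogenous.finrank_neronSeveriGroup_eq_sq_or_eq_choose_of_card_eq_one`** (`r(A) = 1`, elliptic
  factor: `ρ(A) ∈ {g², C(g+1,2)}`), `IsIsogenous.card_le_finrank_of_powers` (`r(A) ≤ g`),
  **`IsIsogenous.finrank_neronSeveriGroup_le_sq_sub_two_add_two_of_three_le_card`** (`r(A) ≥ 3 ⟹
  ρ(A) ≤ (g−2)² + 2`, every abelian variety), `IsIsogenous.exists_two_factors_of_card_eq_two`.
* §4 **Thm. 1.1 (2): `IsIsogenous.not_lt_finrank_neronSeveriGroup_lt_secondGap_of_powers`** (`g ≥ 7`).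
* §5 **Thm. 4.1 ((1) ⟺ (2)) on the decomposition: `IsIsogenous.finrank_neronSeveriGroup_eq_sq_iff_of_powers`**
  (`ρ(A) = g²` iff `r(A) = 1` with an elliptic factor, CM when `g ≥ 2`),
  **Thm. 4.2 (1): `IsIsogenous.finrank_neronSeveriGroup_eq_sq_pred_add_one_iff_of_powers`** (`g ≥ 5`) and
  **Thm. 4.2 (2): `IsIsogenous.finrank_neronSeveriGroup_eq_sq_sub_two_add_four_iff_of_powers`** (`g ≥ 7`),
  both as `iff` statements on the Poincaré decomposition (length `2`, elliptic factors, exponents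
  `(g−1, 1)` with the big factor CM, resp. both factors CM with an exponent `2`).

Scope (recorded): the cases `A ∼ Bᵏ` with `dim B ≥ 2`, `Eᵏ × Bˡ` and `Aᵏ × Bˡ` (§3.3 Steps 2–3, §4 (a)–(b))
are exactly those the paper settles with Cor. 2.5 (Murty); they are excluded by hypothesis here.
-- TODO(general form): Murty 1984 Lemma 3.3 / HL Prop. 2.4, Cor. 2.5 (`ρ(Bᵏ)` by Albert type).

## References

* [HulekLaface2019PicardNumbersAV] K. Hulek, R. Laface, *On the Picard numbers of abelian varieties*,
  Ann. Sc. Norm. Super. Pisa Cl. Sci. (5) XIX (2019) 1199–1224 (arXiv:1703.05882), Thm. 1.1 (2), §2.2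
  Cor. 2.5 / Cor. 2.6, §3.1 Prop. 3.1, Rem. 3.3, §3.3 (Steps 1–3), §4 Thm. 4.1, Thm. 4.2.
* [Lange2023AbelianVarietiesComplex] H. Lange, *Abelian Varieties over the Complex Numbers*, Grundlehren
  Text Edition, Springer (2023), §1.1.6 Exercise (1)(a) (one-dimensional tori), §2.4.4 Thm. 2.4.25
  (Poincaré's complete reducibility), §2.6.1 Cor. 2.6.4, §7.3.3 Exercise (3) (`ρ(E_τⁿ)`).
-/

noncomputable section

open Module Matrix Function
open Complex (I)

namespace Literature.Geometry.Kaehler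

namespace ComplexTorus

/-- The covering space `E ≅ ℝ^ι` of a complex torus is finite-dimensional over `ℂ`. [cite: Lange2023AbelianVarietiesComplex, §1.1.1] -/
private theorem finiteDimensional_complex_of_period {ι : Type*} [Fintype ι] {E : Type*} [NormedAddCommGroup E]
    [NormedSpace ℂ E] (Φ : (ι → ℝ) ≃L[ℝ] E) : FiniteDimensional ℂ E := by
  haveI : FiniteDimensional ℝ E := LinearEquiv.finiteDimensional Φ.toLinearEquiv
  exact Module.Finite.of_restrictScalars_finite ℝ ℂ E

/-- `dim_ℂ (Eᵐ) = m · dim_ℂ E`. [folklore] -/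
private theorem finrank_fin_fun (m : ℕ) (E : Type*) [NormedAddCommGroup E] [NormedSpace ℂ E]
    [FiniteDimensional ℂ E] : finrank ℂ (Fin m → E) = m * finrank ℂ E := by
  rw [Module.finrank_pi_fintype, Finset.sum_const, Finset.card_univ, Fintype.card_fin, smul_eq_mul]

/-! ## §1 The elementary inequalities of §3.3 and §4 -/

section Arithmetic

/-- `2 · C(k+1, 2) = (k+1) k`. [folklore] -/
private theorem two_mul_choose_succ_two : ∀ k : ℕ, 2 * (k + 1).choose 2 = (k + 1) * k
  | 0 => by decide
  | k + 1 => by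
    have ih := two_mul_choose_succ_two k
    rw [Nat.choose_succ_succ (k + 1) 1, Nat.choose_one_right, mul_add, ih]
    ring

/-- `C(k+1, 2) ≤ k²` (`ρ(Eᵏ) ≤ k²` for a curve without complex multiplication; the same inequality is
`Literature.Barriers.PneNP.choose_succ_two_le_sq`, kept private here to avoid a cross-topic import). [cite: HulekLaface2019PicardNumbersAV, §2.2 Cor. 2.6] -/
private theorem choose_succ_two_le_sq (k : ℕ) : (k + 1).choose 2 ≤ k ^ 2 := by
  have h := two_mul_choose_succ_two k
  nlinarith

/-- `C(a+1, 2) + 1 ≤ a²` for `a ≥ 2` ("if one of the factors does not have complex multiplication then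
`ρ(A) ≤ 3 + (g−2)²`"). [cite: HulekLaface2019PicardNumbersAV, §4 Thm. 4.2 (proof, case (c))] -/
theorem choose_succ_two_add_one_le_sq {a : ℕ} (ha : 2 ≤ a) : (a + 1).choose 2 + 1 ≤ a ^ 2 := by
  have h := two_mul_choose_succ_two a
  obtain ⟨c, rfl⟩ : ∃ c, a = c + 2 := ⟨a - 2, by omega⟩
  nlinarith

/-- §3.3, `r(A) = 1`, `b = 1`: `C(g+1, 2) < (g−2)² + 4` for `g ≥ 7` ("`ρ(A) = ½ g(g+1) < (g−2)² + 4`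
(as `g ≥ 7`)"). [cite: HulekLaface2019PicardNumbersAV, §3.3 (case `r(A) = 1`)] -/
theorem choose_succ_two_lt_sq_sub_two_add_four {g : ℕ} (hg : 7 ≤ g) : (g + 1).choose 2 < (g - 2) ^ 2 + 4 := by
  have h := two_mul_choose_succ_two g
  obtain ⟨c, rfl⟩ : ∃ c, g = c + 7 := ⟨g - 7, by omega⟩
  rw [show c + 7 - 2 = c + 5 by omega]
  nlinarith

/-- §3.3 Step 1, `n = 1`, no complex multiplication: `1 + C(g, 2) < (g−2)² + 4` ("one sees that it is
always the case that `1 + ½ g(g−1) ≤ (g−2)² + 4`"; in fact strictly, for every `g`).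
[cite: HulekLaface2019PicardNumbersAV, §3.3 Step 1] -/
theorem one_add_choose_two_lt_sq_sub_two_add_four (g : ℕ) : 1 + g.choose 2 < (g - 2) ^ 2 + 4 := by
  rcases Nat.lt_or_ge g 5 with hg | hg
  · interval_cases g <;> decide
  · obtain ⟨c, rfl⟩ : ∃ c, g = c + 5 := ⟨g - 5, by omega⟩
    have h := two_mul_choose_succ_two (c + 4)
    rw [show c + 5 - 2 = c + 3 by omega]
    rw [show c + 4 + 1 = c + 5 by rfl] at h
    nlinarith

/-- `(g−2)² + 4 < (g−1)² + 1` for `g ≥ 4` (the second gap lies below `M_{2,g}`). [cite: HulekLaface2019PicardNumbersAV, Thm. 1.1 (2) and §3.1 Remark 3.3] -/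
theorem sq_sub_two_add_four_lt_sq_pred_add_one {g : ℕ} (hg : 4 ≤ g) : (g - 2) ^ 2 + 4 < (g - 1) ^ 2 + 1 := by
  obtain ⟨c, rfl⟩ : ∃ c, g = c + 4 := ⟨g - 4, by omega⟩
  rw [show c + 4 - 2 = c + 2 by omega, show c + 4 - 1 = c + 3 by omega]
  nlinarith

/-- `(g−1)² + 1 ≤ g²` for `g ≥ 1` (`M_{2,g} ≤ M_{1,g}`). [cite: HulekLaface2019PicardNumbersAV, §3.1 Remark 3.3] -/
theorem sq_pred_add_one_le_sq {g : ℕ} (hg : 1 ≤ g) : (g - 1) ^ 2 + 1 ≤ g ^ 2 := by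
  obtain ⟨c, rfl⟩ : ∃ c, g = c + 1 := ⟨g - 1, by omega⟩
  rw [Nat.add_sub_cancel]
  nlinarith

/-- §3.3 Step 1, `n ≥ 2`: `a² + b² ≤ (a + b − 2)² + 4` for `a, b ≥ 2` ("`f(x) = x² + (g−x)²` attains its
maximum on `[2, g−2]` at `x = 2` and `x = g−2` with value `(g−2)² + 4`"). [cite: HulekLaface2019PicardNumbersAV, §3.3 Step 1] -/
theorem sq_add_sq_le_sq_sub_two_add_four {a b : ℕ} (ha : 2 ≤ a) (hb : 2 ≤ b) :
    a ^ 2 + b ^ 2 ≤ (a + b - 2) ^ 2 + 4 := by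
  obtain ⟨x, rfl⟩ : ∃ x, a = x + 2 := ⟨a - 2, by omega⟩
  obtain ⟨y, rfl⟩ : ∃ y, b = y + 2 := ⟨b - 2, by omega⟩
  rw [show x + 2 + (y + 2) - 2 = x + y + 2 by omega]
  nlinarith [Nat.zero_le (x * y)]

/-- … with equality only at the ends: `a² + b² = (a + b − 2)² + 4`, `a, b ≥ 2` ⟹ `a = 2 ∨ b = 2` ("The
maximum of this expression is achieved for `n = 2` or `n = g−2`"). [cite: HulekLaface2019PicardNumbersAV, §4 Thm. 4.2 (proof, case (c))] -/
theorem eq_two_or_eq_two_of_sq_add_sq_eq {a b : ℕ} (ha : 2 ≤ a) (hb : 2 ≤ b)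
    (h : a ^ 2 + b ^ 2 = (a + b - 2) ^ 2 + 4) : a = 2 ∨ b = 2 := by
  obtain ⟨x, rfl⟩ : ∃ x, a = x + 2 := ⟨a - 2, by omega⟩
  obtain ⟨y, rfl⟩ : ∃ y, b = y + 2 := ⟨b - 2, by omega⟩
  rw [show x + 2 + (y + 2) - 2 = x + y + 2 by omega] at h
  have hxy : x * y = 0 := by nlinarith
  rcases Nat.mul_eq_zero.1 hxy with hx | hy
  · exact Or.inl (by rw [hx])
  · exact Or.inr (by rw [hy])

/-- `C(g+1, 2) < (g−1)² + 1` for `g ≥ 5` (Thm. 4.2 (1): `ρ(A) = C(g+1, 2)` is "a contradiction"; for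
`g = 4` both sides are `10`). [cite: HulekLaface2019PicardNumbersAV, §4 Thm. 4.2 (proof of (1))] -/
theorem choose_succ_two_lt_sq_pred_add_one {g : ℕ} (hg : 5 ≤ g) : (g + 1).choose 2 < (g - 1) ^ 2 + 1 := by
  have h := two_mul_choose_succ_two g
  obtain ⟨c, rfl⟩ : ∃ c, g = c + 5 := ⟨g - 5, by omega⟩
  rw [show c + 5 - 1 = c + 4 by omega]
  nlinarith

/-- The maxima below the third: `M_{r,g} ≤ M_{3,g} = (g−2)² + 2` for `3 ≤ r ≤ g` (Remark 3.3).
[cite: HulekLaface2019PicardNumbersAV, §3.1 Remark 3.3 and §3.3 ("`ρ(A) ≤ M_{r(A),g} ≤ M_{3,g} < (g−2)² + 4`")] -/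
theorem sq_sub_add_le_sq_sub_two_add_two {g r : ℕ} (h3 : 3 ≤ r) (hrg : r ≤ g) :
    (g - (r - 1)) ^ 2 + (r - 1) ≤ (g - 2) ^ 2 + 2 := by
  rcases h3.eq_or_lt with h | h
  · subst h
    exact le_of_eq rfl
  · exact (sq_sub_add_lt_sq_sub_add (g := g) (r := 3) (r' := r) (by norm_num) h hrg).le

/-- **§3.3 Step 1 (the numbers): for `A ∼ E_1^a × E_2^b` (`a, b ≥ 1`, `g = a + b`), with
`ρ(E_1^a) ∈ {a², C(a+1, 2)}` and `ρ(E_2^b) ∈ {b², C(b+1, 2)}`, the sum `ρ = ρ(E_1^a) + ρ(E_2^b)` is never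
in the range `(g−2)² + 4 < ρ < (g−1)² + 1`.** [cite: HulekLaface2019PicardNumbersAV, §3.3 Step 1] -/
theorem not_lt_add_lt_of_pow_dichotomy {a b p q : ℕ} (ha : 0 < a) (hb : 0 < b)
    (hp : p = a ^ 2 ∨ p = (a + 1).choose 2) (hq : q = b ^ 2 ∨ q = (b + 1).choose 2) :
    ¬ ((a + b - 2) ^ 2 + 4 < p + q ∧ p + q < (a + b - 1) ^ 2 + 1) := by
  rintro ⟨hlo, hhi⟩
  have hple : p ≤ a ^ 2 := by
    rcases hp with h | h
    · exact h.le
    · rw [h]; exact choose_succ_two_le_sq a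
  have hqle : q ≤ b ^ 2 := by
    rcases hq with h | h
    · exact h.le
    · rw [h]; exact choose_succ_two_le_sq b
  rcases Nat.lt_or_ge a 2 with ha2 | ha2
  · -- `a = 1`: `ρ = 1 + ρ(E_2^{g−1})`
    obtain rfl : a = 1 := by omega
    have hp1 : p = 1 := by rcases hp with h | h <;> simpa using h
    rw [hp1, show 1 + b - 2 = b - 1 by omega] at hlo
    rw [hp1, show 1 + b - 1 = b by omega] at hhi
    rcases hq with h | h
    · omega
    · rw [h] at hlo
      have := one_add_choose_two_lt_sq_sub_two_add_four (b + 1)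
      rw [show b + 1 - 2 = b - 1 by omega] at this
      omega
  · rcases Nat.lt_or_ge b 2 with hb2 | hb2
    · obtain rfl : b = 1 := by omega
      have hq1 : q = 1 := by rcases hq with h | h <;> simpa using h
      rw [hq1, show a + 1 - 2 = a - 1 by omega] at hlo
      rw [hq1, show a + 1 - 1 = a by omega] at hhi
      rcases hp with h | h
      · omega
      · rw [h] at hlo
        have := one_add_choose_two_lt_sq_sub_two_add_four (a + 1)
        rw [show a + 1 - 2 = a - 1 by omega] at this
        omega
    · have := sq_add_sq_le_sq_sub_two_add_four ha2 hb2
      omega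

/-- **Thm. 4.2 (2), case (c) (the numbers): for `A ∼ E_1^a × E_2^b` (`a, b ≥ 1`, `g = a + b ≥ 7`) with
`ρ(E_iᵏ) ∈ {k², C(k+1, 2)}`, the equation `ρ(E_1^a) + ρ(E_2^b) = (g−2)² + 4` forces `a, b ≥ 2`,
`ρ(E_1^a) = a²`, `ρ(E_2^b) = b²` (both CM) and `{a, b} ∋ 2`.**
[cite: HulekLaface2019PicardNumbersAV, §4 Thm. 4.2 (proof of (2), case (c))] -/
theorem eq_sq_of_add_eq_sq_sub_two_add_four {a b p q : ℕ} (ha : 0 < a) (hb : 0 < b) (hg : 7 ≤ a + b)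
    (hp : p = a ^ 2 ∨ p = (a + 1).choose 2) (hq : q = b ^ 2 ∨ q = (b + 1).choose 2)
    (h : p + q = (a + b - 2) ^ 2 + 4) : 2 ≤ a ∧ 2 ≤ b ∧ p = a ^ 2 ∧ q = b ^ 2 ∧ (a = 2 ∨ b = 2) := by
  have hple : p ≤ a ^ 2 := by
    rcases hp with h | h
    · exact h.le
    · rw [h]; exact choose_succ_two_le_sq a
  have hqle : q ≤ b ^ 2 := by
    rcases hq with h | h
    · exact h.le
    · rw [h]; exact choose_succ_two_le_sq b
  have ha2 : 2 ≤ a := by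
    by_contra hlt
    obtain rfl : a = 1 := by omega
    have hp1 : p = 1 := by rcases hp with h | h <;> simpa using h
    rw [hp1, show 1 + b - 2 = b - 1 by omega] at h
    rcases hq with h' | h'
    · have := sq_sub_two_add_four_lt_sq_pred_add_one (g := 1 + b) (by omega)
      rw [show 1 + b - 2 = b - 1 by omega, show 1 + b - 1 = b by omega] at this
      omega
    · have := one_add_choose_two_lt_sq_sub_two_add_four (b + 1)
      rw [show b + 1 - 2 = b - 1 by omega] at this
      omega
  have hb2 : 2 ≤ b := by
    by_contra hlt
    obtain rfl : b = 1 := by omega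
    have hq1 : q = 1 := by rcases hq with h | h <;> simpa using h
    rw [hq1, show a + 1 - 2 = a - 1 by omega] at h
    rcases hp with h' | h'
    · have := sq_sub_two_add_four_lt_sq_pred_add_one (g := a + 1) (by omega)
      rw [show a + 1 - 2 = a - 1 by omega, show a + 1 - 1 = a by omega] at this
      omega
    · have := one_add_choose_two_lt_sq_sub_two_add_four (a + 1)
      rw [show a + 1 - 2 = a - 1 by omega] at this
      omega
  have hbound := sq_add_sq_le_sq_sub_two_add_four ha2 hb2
  have hpa : p = a ^ 2 := by
    rcases hp with h' | h'
    · exact h'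
    · exfalso
      have := choose_succ_two_add_one_le_sq ha2
      omega
  have hqb : q = b ^ 2 := by
    rcases hq with h' | h'
    · exact h'
    · exfalso
      have := choose_succ_two_add_one_le_sq hb2
      omega
  subst hpa hqb
  exact ⟨ha2, hb2, rfl, rfl, eq_two_or_eq_two_of_sq_add_sq_eq ha2 hb2 h⟩

end Arithmetic

/-! ## §2 The Picard number of a power of an elliptic curve, for an abstract one-dimensional torus -/

section EllipticPow

variable {ι : Type*} [Fintype ι] [DecidableEq ι] {E : Type*} [NormedAddCommGroup E]
  [NormedSpace ℂ E] (X : (ι → ℝ) ≃L[ℝ] E)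

/-- A one-dimensional torus WITHOUT complex multiplication is `E_θ` with `θ` not imaginary quadratic.
[cite: Lange2023AbelianVarietiesComplex, §1.1.6 Exercise (1)(a) and §2.6.1 Cor. 2.6.4] -/
theorem exists_isIsomorphic_ellipticPeriod_forall_ne (hd : finrank ℂ E = 1) (hncm : finrank ℚ (endAlgRat X) ≠ 2) :
    ∃ (θ : ℂ) (hθ : θ.im ≠ 0), IsIsomorphic X (ellipticPeriod hθ) ∧ ∀ a b : ℚ, θ ^ 2 + a * θ + b ≠ 0 := by
  obtain ⟨θ, hθ, hXE⟩ := exists_isIsomorphic_ellipticPeriod X hd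
  refine ⟨θ, hθ, hXE, fun a b hab ↦ hncm ?_⟩
  rw [hXE.isIsogenous.finrank_endAlgRat_eq, finrank_endAlgRat_ellipticPeriod_eq_two_iff,
    ComplexTorus.ellipticEnd_ne_bot_iff]
  exact ⟨a, b, hab⟩

/-- **`ρ(Eᵏ) = k²` for an elliptic curve with complex multiplication** (every `k ≥ 0`), for an abstract
one-dimensional torus `E` with `dim_ℚ End_ℚ(E) = 2`. [cite: HulekLaface2019PicardNumbersAV, §2.2 Cor. 2.6] -/
theorem finrank_neronSeveriGroup_pow_of_cm (hd : finrank ℂ E = 1) (hcm : finrank ℚ (endAlgRat X) = 2) (k : ℕ) :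
    finrank ℤ (neronSeveriGroup (powPeriod X k)) = k ^ 2 := by
  haveI : FiniteDimensional ℂ E := finiteDimensional_complex_of_period X
  rcases Nat.lt_or_ge k 2 with hk | hk
  · interval_cases k
    · have h := finrank_neronSeveriGroup_powPeriod_le_sq X 0
      rw [zero_mul] at h
      exact Nat.le_zero.1 (by simpa using h)
    · rw [one_pow]
      exact finrank_neronSeveriGroup_eq_one_of_finrank_eq_one _ (by rw [finrank_fin_fun, hd])
  · exact (finrank_neronSeveriGroup_pow_eq_sq_iff_of_finrank_eq_one X hk hd).2 hcm

/-- **`ρ(Eᵏ) = C(k+1, 2) = ½ k(k+1)` for an elliptic curve without complex multiplication** (every `k`).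
[cite: HulekLaface2019PicardNumbersAV, §2.2 Cor. 2.6] [cite: Lange2023AbelianVarietiesComplex, §7.3.3 Exercise (3)] -/
theorem finrank_neronSeveriGroup_pow_of_not_cm (hd : finrank ℂ E = 1) (hncm : finrank ℚ (endAlgRat X) ≠ 2)
    (k : ℕ) : finrank ℤ (neronSeveriGroup (powPeriod X k)) = (k + 1).choose 2 := by
  obtain ⟨θ, hθ, hXE, hq⟩ := exists_isIsomorphic_ellipticPeriod_forall_ne X hd hncm
  exact (hXE.isIsogenous.pow _ _ k).finrank_neronSeveriGroup_eq_choose_of_forall_ne _ hθ k hq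

/-- `ρ(Eᵏ) ∈ {k², C(k+1, 2)}` (Corollary 2.6). [cite: HulekLaface2019PicardNumbersAV, §2.2 Cor. 2.6] -/
theorem finrank_neronSeveriGroup_pow_eq_sq_or_eq_choose (hd : finrank ℂ E = 1) (k : ℕ) :
    finrank ℤ (neronSeveriGroup (powPeriod X k)) = k ^ 2 ∨
      finrank ℤ (neronSeveriGroup (powPeriod X k)) = (k + 1).choose 2 := by
  by_cases hcm : finrank ℚ (endAlgRat X) = 2
  · exact Or.inl (finrank_neronSeveriGroup_pow_of_cm X hd hcm k)
  · exact Or.inr (finrank_neronSeveriGroup_pow_of_not_cm X hd hcm k)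

/-- `ρ(Eᵏ) = k²` with `k ≥ 2` ⟹ `E` has complex multiplication. [cite: HulekLaface2019PicardNumbersAV, §2.2 Cor. 2.6] -/
theorem finrank_endAlgRat_eq_two_of_pow_eq_sq (hd : finrank ℂ E = 1) {k : ℕ} (hk : 2 ≤ k)
    (h : finrank ℤ (neronSeveriGroup (powPeriod X k)) = k ^ 2) : finrank ℚ (endAlgRat X) = 2 := by
  haveI : FiniteDimensional ℂ E := finiteDimensional_complex_of_period X
  exact (finrank_neronSeveriGroup_pow_eq_sq_iff_of_finrank_eq_one X hk hd).1 h

end EllipticPow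

/-! ## §3 Poincaré decompositions of length `≤ 2` -/

section LengthTwo

variable {ι : Type*} [Fintype ι] [DecidableEq ι] {E : Type*} [NormedAddCommGroup E] [NormedSpace ℂ E]
  {ρ : Type*} [Fintype ρ] [DecidableEq ρ] {τ : ρ → Type*} [∀ ν, Fintype (τ ν)] [∀ ν, DecidableEq (τ ν)]
  [∀ ν, Nonempty (τ ν)]
  {G : ρ → Type*} [∀ ν, NormedAddCommGroup (G ν)] [∀ ν, NormedSpace ℂ (G ν)]
  (X : ∀ ν, (τ ν → ℝ) ≃L[ℝ] G ν) (n : ρ → ℕ)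

omit [∀ ν, DecidableEq (τ ν)] [∀ ν, Nonempty (τ ν)] in
/-- An index set with two elements. [folklore] -/
private theorem exists_pair_univ_of_card_eq_two (h : Fintype.card ρ = 2) :
    ∃ x y : ρ, x ≠ y ∧ (Finset.univ : Finset ρ) = {x, y} := by
  obtain ⟨x, y, hxy, hu⟩ := Finset.card_eq_two.1 ((Finset.card_univ (α := ρ)).trans h)
  exact ⟨x, y, hxy, hu⟩

omit [∀ ν, Nonempty (τ ν)] in
/-- `ρ(X_x^{a} × X_y^{b}) = ρ(X_x^{a}) + ρ(X_y^{b})` for a two-element Poincaré decomposition.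
[cite: HulekLaface2019PicardNumbersAV, §2.1 Cor. 2.3] -/
theorem finrank_neronSeveriGroup_powers_of_univ_eq_pair (hX : ∀ ν, IsSimple (X ν))
    (hA : ∀ ν, IsAbelianVariety (X ν)) (hXX : ∀ ν ν', ν ≠ ν' → ¬ IsIsogenous (X ν) (X ν')) {x y : ρ}
    (hxy : x ≠ y) (hu : (Finset.univ : Finset ρ) = {x, y}) :
    finrank ℤ (neronSeveriGroup (sigmaPiPeriod fun ν ↦ powPeriod (X ν) (n ν))) =
      finrank ℤ (neronSeveriGroup (powPeriod (X x) (n x))) +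
        finrank ℤ (neronSeveriGroup (powPeriod (X y) (n y))) := by
  rw [finrank_neronSeveriGroup_powers X n hX hA hXX, hu, Finset.sum_pair hxy]

omit [∀ ν, DecidableEq (τ ν)] [∀ ν, Nonempty (τ ν)] in
include X in
/-- `dim (X_x^{a} × X_y^{b}) = a + b` for elliptic `X_x`, `X_y`. [cite: HulekLaface2019PicardNumbersAV, §3.3 Step 1] -/
theorem finrank_powers_of_univ_eq_pair (hd : ∀ ν, finrank ℂ (G ν) = 1) {x y : ρ} (hxy : x ≠ y)
    (hu : (Finset.univ : Finset ρ) = {x, y}) :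
    finrank ℂ (∀ ν, Fin (n ν) → G ν) = n x + n y := by
  rw [finrank_powers_eq X n, hu, Finset.sum_pair hxy, hd, hd, mul_one, mul_one]

omit [DecidableEq ρ] [∀ ν, Nonempty (τ ν)] in
/-- **§3.3, the case `r(A) = 1` with an elliptic factor: `A ∼ Bᵍ`, `dim B = 1` ⟹ `ρ(A) = g²` or
`ρ(A) = C(g+1, 2)`** (`g = dim A`). [cite: HulekLaface2019PicardNumbersAV, §3.3 ("If `b = 1`, then `B` is an elliptic curve …")] -/
theorem IsIsogenous.finrank_neronSeveriGroup_eq_sq_or_eq_choose_of_card_eq_one {A : (ι → ℝ) ≃L[ℝ] E}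
    (hiso : IsIsogenous A (sigmaPiPeriod fun ν ↦ powPeriod (X ν) (n ν))) (h1 : Fintype.card ρ = 1)
    (hd : ∀ ν, finrank ℂ (G ν) = 1) :
    finrank ℤ (neronSeveriGroup A) = finrank ℂ E ^ 2 ∨
      finrank ℤ (neronSeveriGroup A) = (finrank ℂ E + 1).choose 2 := by
  obtain ⟨ν₀, huniq⟩ := Fintype.card_eq_one_iff.1 h1
  letI : Unique ρ := { default := ν₀, uniq := huniq }
  haveI : FiniteDimensional ℂ (G ν₀) := finiteDimensional_complex_of_period (X ν₀)
  have hAX : IsIsogenous A (powPeriod (X ν₀) (n ν₀)) :=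
    IsIsogenous.trans _ _ _ hiso (isIsomorphic_sigmaPiPeriod_unique fun ν ↦ powPeriod (X ν) (n ν)).isIsogenous
  have hg : finrank ℂ E = n ν₀ := by rw [hAX.finrank_eq _ _, finrank_fin_fun, hd, mul_one]
  rw [hAX.finrank_neronSeveriGroup_eq _ _, hg]
  exact finrank_neronSeveriGroup_pow_eq_sq_or_eq_choose (X ν₀) (hd ν₀) (n ν₀)

omit [DecidableEq ρ] [∀ ν, DecidableEq (τ ν)] in
/-- `r(A) ≤ dim A` along a Poincaré decomposition (every isotypic factor has dimension `≥ 1`).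
[cite: HulekLaface2019PicardNumbersAV, §3.1 (definition of `r(A)` and `M_{r,g}` "for `r ≤ g`")] -/
theorem IsIsogenous.card_le_finrank_of_powers {A : (ι → ℝ) ≃L[ℝ] E}
    (hiso : IsIsogenous A (sigmaPiPeriod fun ν ↦ powPeriod (X ν) (n ν))) (hn : ∀ ν, 0 < n ν) :
    Fintype.card ρ ≤ finrank ℂ E := by
  rw [hiso.finrank_eq _ _, finrank_powers_eq X n]
  calc Fintype.card ρ = ∑ _ν : ρ, 1 := by simp
    _ ≤ ∑ ν, n ν * finrank ℂ (G ν) := Finset.sum_le_sum fun ν _ ↦ one_le_mul_finrank X n hn ν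

/-- **§3.3, first reduction, for every abelian variety: `r(A) ≥ 3 ⟹ ρ(A) ≤ M_{3,g} = (g−2)² + 2`**
("if `r(A) ≥ 3`, then `ρ(A) ≤ M_{r(A),g} ≤ M_{3,g} < (g−2)² + 4`"). [cite: HulekLaface2019PicardNumbersAV, §3.3] -/
theorem IsIsogenous.finrank_neronSeveriGroup_le_sq_sub_two_add_two_of_three_le_card {A : (ι → ℝ) ≃L[ℝ] E}
    (hiso : IsIsogenous A (sigmaPiPeriod fun ν ↦ powPeriod (X ν) (n ν))) (hX : ∀ ν, IsSimple (X ν))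
    (hA : ∀ ν, IsAbelianVariety (X ν)) (hXX : ∀ ν ν', ν ≠ ν' → ¬ IsIsogenous (X ν) (X ν'))
    (hn : ∀ ν, 0 < n ν) (h3 : 3 ≤ Fintype.card ρ) :
    finrank ℤ (neronSeveriGroup A) ≤ (finrank ℂ E - 2) ^ 2 + 2 :=
  (hiso.finrank_neronSeveriGroup_le_of_powers X n hX hA hXX hn).trans
    (sq_sub_add_le_sq_sub_two_add_two h3 (hiso.card_le_finrank_of_powers X n hn))

omit [∀ ν, Nonempty (τ ν)] in
/-- **The two-factor case with elliptic curves: `A ∼ E_1^a × E_2^b` ⟹ `dim A = a + b` and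
`ρ(A) = ρ(E_1^a) + ρ(E_2^b)`.** [cite: HulekLaface2019PicardNumbersAV, §3.3 Step 1 and §2.1 Cor. 2.3] -/
theorem IsIsogenous.exists_two_factors_of_card_eq_two {A : (ι → ℝ) ≃L[ℝ] E}
    (hiso : IsIsogenous A (sigmaPiPeriod fun ν ↦ powPeriod (X ν) (n ν))) (hX : ∀ ν, IsSimple (X ν))
    (hA : ∀ ν, IsAbelianVariety (X ν)) (hXX : ∀ ν ν', ν ≠ ν' → ¬ IsIsogenous (X ν) (X ν'))
    (h2 : Fintype.card ρ = 2) (hd : ∀ ν, finrank ℂ (G ν) = 1) :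
    ∃ x y : ρ, x ≠ y ∧ (Finset.univ : Finset ρ) = {x, y} ∧ finrank ℂ E = n x + n y ∧
      finrank ℤ (neronSeveriGroup A) =
        finrank ℤ (neronSeveriGroup (powPeriod (X x) (n x))) +
          finrank ℤ (neronSeveriGroup (powPeriod (X y) (n y))) := by
  obtain ⟨x, y, hxy, hu⟩ := exists_pair_univ_of_card_eq_two h2
  refine ⟨x, y, hxy, hu, ?_, ?_⟩
  · rw [hiso.finrank_eq _ _, finrank_powers_of_univ_eq_pair X n hd hxy hu]
  · rw [hiso.finrank_neronSeveriGroup_eq _ _, finrank_neronSeveriGroup_powers_of_univ_eq_pair X n hX hA hXX hxy hu]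

end LengthTwo

/-! ## §4 Thm. 1.1 (2): the second gap `(g−2)² + 4 < ρ < (g−1)² + 1`, `g ≥ 7` -/

section SecondGap

variable {ι : Type*} [Fintype ι] [DecidableEq ι] {E : Type*} [NormedAddCommGroup E] [NormedSpace ℂ E]
  {ρ : Type*} [Fintype ρ] [DecidableEq ρ] {τ : ρ → Type*} [∀ ν, Fintype (τ ν)] [∀ ν, DecidableEq (τ ν)]
  [∀ ν, Nonempty (τ ν)]
  {G : ρ → Type*} [∀ ν, NormedAddCommGroup (G ν)] [∀ ν, NormedSpace ℂ (G ν)]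
  (X : ∀ ν, (τ ν → ℝ) ≃L[ℝ] G ν) (n : ρ → ℕ)

/-- **Hulek–Laface 2019, Thm. 1.1 (2), for every abelian variety of dimension `g ≥ 7` whose Poincaré
decomposition, when of length `≤ 2`, consists of elliptic curves**: the Picard number is NOT in the range
`(g−2)² + 4 < ρ < (g−1)² + 1`. The proof follows §3.3: `r(A) ≥ 3` by Prop. 3.1 (`M_{3,g} = (g−2)² + 2`);
`r(A) = 1`, `A ∼ Eᵍ`: `ρ = g²` or `C(g+1, 2) < (g−2)² + 4`; `r(A) = 2`, `A ∼ E_1^a × E_2^{g−a}` (Step 1):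
`not_lt_add_lt_of_pow_dichotomy`. The cases `A ∼ Bᵏ` (`dim B ≥ 2`), `Eᵏ × Bˡ` and `Aᵏ × Bˡ` (Steps 2,
3) rest on Murty's bound (Cor. 2.5) and are NOT covered here.
-- TODO(general form): Cor. 2.5 `ρ(Bᵏ) ≤ ½ nk(2k+1)` for a simple `B` of dimension `n` (Murty 1984).
[cite: HulekLaface2019PicardNumbersAV, Thm. 1.1 (2) and §3.3] -/
theorem IsIsogenous.not_lt_finrank_neronSeveriGroup_lt_secondGap_of_powers
    {A : (ι → ℝ) ≃L[ℝ] E} (hiso : IsIsogenous A (sigmaPiPeriod fun ν ↦ powPeriod (X ν) (n ν)))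
    (hX : ∀ ν, IsSimple (X ν)) (hA : ∀ ν, IsAbelianVariety (X ν))
    (hXX : ∀ ν ν', ν ≠ ν' → ¬ IsIsogenous (X ν) (X ν')) (hn : ∀ ν, 0 < n ν) (hg : 7 ≤ finrank ℂ E)
    (hell : Fintype.card ρ ≤ 2 → ∀ ν, finrank ℂ (G ν) = 1) :
    ¬ ((finrank ℂ E - 2) ^ 2 + 4 < finrank ℤ (neronSeveriGroup A) ∧
      finrank ℤ (neronSeveriGroup A) < (finrank ℂ E - 1) ^ 2 + 1) := by
  rintro ⟨hlo, hhi⟩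
  rcases Nat.lt_or_ge (Fintype.card ρ) 3 with hr | hr
  · have hd := hell (by omega)
    rcases Nat.lt_or_ge (Fintype.card ρ) 2 with hr1 | hr2
    · -- `r(A) = 1`: `A ∼ Eᵍ` (`r(A) = 0` would make `A` a point)
      rcases Nat.lt_or_ge (Fintype.card ρ) 1 with hr0 | hr0
      · haveI : IsEmpty ρ := Fintype.card_eq_zero_iff.1 (by omega)
        have hE : finrank ℂ E = 0 := by
          rw [hiso.finrank_eq _ _, finrank_powers_eq X n, Finset.univ_eq_empty, Finset.sum_empty]
        omega
      have h1 : Fintype.card ρ = 1 := by omega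
      rcases hiso.finrank_neronSeveriGroup_eq_sq_or_eq_choose_of_card_eq_one X n h1 hd with h | h
      · have := sq_pred_add_one_le_sq (g := finrank ℂ E) (by omega)
        omega
      · have := choose_succ_two_lt_sq_sub_two_add_four hg
        omega
    · -- `r(A) = 2`: `A ∼ E_1^a × E_2^b`, Step 1
      obtain ⟨x, y, -, -, hgab, hρ⟩ := hiso.exists_two_factors_of_card_eq_two X n hX hA hXX (by omega) hd
      rw [hρ, hgab] at hlo hhi
      exact not_lt_add_lt_of_pow_dichotomy (hn x) (hn y)
        (finrank_neronSeveriGroup_pow_eq_sq_or_eq_choose (X x) (hd x) (n x))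
        (finrank_neronSeveriGroup_pow_eq_sq_or_eq_choose (X y) (hd y) (n y)) ⟨hlo, hhi⟩
  · -- `r(A) ≥ 3`
    have := hiso.finrank_neronSeveriGroup_le_sq_sub_two_add_two_of_three_le_card X n hX hA hXX hn hr
    omega

end SecondGap

/-! ## §5 Thm. 4.2: the structure of abelian varieties with `ρ = (g−1)² + 1` and `ρ = (g−2)² + 4` -/

section Structure

variable {ι : Type*} [Fintype ι] [DecidableEq ι] {E : Type*} [NormedAddCommGroup E] [NormedSpace ℂ E]
  {ρ : Type*} [Fintype ρ] [DecidableEq ρ] {τ : ρ → Type*} [∀ ν, Fintype (τ ν)] [∀ ν, DecidableEq (τ ν)]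
  [∀ ν, Nonempty (τ ν)]
  {G : ρ → Type*} [∀ ν, NormedAddCommGroup (G ν)] [∀ ν, NormedSpace ℂ (G ν)]
  (X : ∀ ν, (τ ν → ℝ) ≃L[ℝ] G ν) (n : ρ → ℕ)

/-- **Hulek–Laface 2019, Thm. 4.1 ((1) ⟺ (2), = Lange 2023 Exercise 5.6.10) read on a Poincaré
decomposition: `ρ(A) = g²` iff `r(A) = 1` and the simple factor is an elliptic curve, with complex
multiplication when `g ≥ 2`** ("`ρ(A) = g²` ⟺ `A ∼ E^g`, for some elliptic curve `E` with complex
multiplication"). `r(A) ≥ 2` is excluded by Prop. 3.1 (`ρ ≤ (g−1)² + 1 < g²`); `r(A) = 1` is Cor. 3.2.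
[cite: HulekLaface2019PicardNumbersAV, §4 Thm. 4.1] [cite: Lange2023AbelianVarietiesComplex, §2.6.3 Exercise (2)] -/
theorem IsIsogenous.finrank_neronSeveriGroup_eq_sq_iff_of_powers [Nonempty ρ]
    {A : (ι → ℝ) ≃L[ℝ] E} (hiso : IsIsogenous A (sigmaPiPeriod fun ν ↦ powPeriod (X ν) (n ν)))
    (hX : ∀ ν, IsSimple (X ν)) (hA : ∀ ν, IsAbelianVariety (X ν))
    (hXX : ∀ ν ν', ν ≠ ν' → ¬ IsIsogenous (X ν) (X ν')) (hn : ∀ ν, 0 < n ν) :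
    finrank ℤ (neronSeveriGroup A) = finrank ℂ E ^ 2 ↔
      Fintype.card ρ = 1 ∧ ∀ ν, finrank ℂ (G ν) = 1 ∧ (2 ≤ n ν → finrank ℚ (endAlgRat (X ν)) = 2) := by
  constructor
  · intro h
    have h1 : Fintype.card ρ = 1 := by
      by_contra hne
      have h2 : 2 ≤ Fintype.card ρ := by
        have := Fintype.card_pos (α := ρ)
        omega
      have hle := hiso.finrank_neronSeveriGroup_le_sq_pred_add_one_of_two_le_card X n hX hA hXX hn h2
      have hg2 : 2 ≤ finrank ℂ E := h2.trans (hiso.card_le_finrank_of_powers X n hn)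
      obtain ⟨c, hc⟩ : ∃ c, finrank ℂ E = c + 2 := ⟨finrank ℂ E - 2, by omega⟩
      rw [h, hc, show c + 2 - 1 = c + 1 by omega] at hle
      nlinarith
    refine ⟨h1, fun ν ↦ ?_⟩
    obtain ⟨ν₁, huniq⟩ := Fintype.card_eq_one_iff.1 h1
    have key := (hiso.finrank_neronSeveriGroup_eq_iff_of_powers X n hX hA hXX hn).1 (by rw [h, h1]; simp)
    obtain ⟨ν₀, hd, -, hcm⟩ := key
    obtain rfl : ν = ν₀ := (huniq ν).trans (huniq ν₀).symm
    exact ⟨hd ν, hcm⟩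
  · rintro ⟨h1, hall⟩
    obtain ⟨ν₀, huniq⟩ := Fintype.card_eq_one_iff.1 h1
    have key := (hiso.finrank_neronSeveriGroup_eq_iff_of_powers X n hX hA hXX hn).2
      ⟨ν₀, fun ν ↦ (hall ν).1, fun ν hν ↦ absurd ((huniq ν).trans (huniq ν₀).symm) hν, (hall ν₀).2⟩
    rw [key, h1]
    simp

/-- **Hulek–Laface 2019, Thm. 4.2 (1), for every abelian variety of dimension `g ≥ 5` outside Murty's
case `A ∼ Bᵏ` (`B` simple of dimension `≥ 2`):** `ρ(A) = (g−1)² + 1` iff the Poincaré decomposition of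
`A` has length `2`, all its factors are elliptic curves, all exponents but one (`n_{ν₀}`) equal `1`, and
`X_{ν₀}` has complex multiplication ("`ρ(A) = (g−1)² + 1 ⟺ A ∼ E_1^{g−1} × E_2`, where `E_1` has complex
multiplication and `E_1` and `E_2` are not isogeneous"). Proof as printed: `r(A) ≥ 3` is excluded by
`M_{3,g} < M_{2,g}`, `r(A) = 1` by `ρ(Eᵍ) ∈ {g², C(g+1, 2)} ∌ (g−1)² + 1` (`g ≥ 5`), and `r(A) = 2` is
Cor. 3.2 (`IsIsogenous.finrank_neronSeveriGroup_eq_iff_of_powers`).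
-- TODO(general form): the excluded case `A ∼ Bᵏ`, `dim B ≥ 2`, needs Murty's Cor. 2.5.
[cite: HulekLaface2019PicardNumbersAV, §4 Thm. 4.2 (1)] -/
theorem IsIsogenous.finrank_neronSeveriGroup_eq_sq_pred_add_one_iff_of_powers [Nonempty ρ]
    {A : (ι → ℝ) ≃L[ℝ] E} (hiso : IsIsogenous A (sigmaPiPeriod fun ν ↦ powPeriod (X ν) (n ν)))
    (hX : ∀ ν, IsSimple (X ν)) (hA : ∀ ν, IsAbelianVariety (X ν))
    (hXX : ∀ ν ν', ν ≠ ν' → ¬ IsIsogenous (X ν) (X ν')) (hn : ∀ ν, 0 < n ν) (hg : 5 ≤ finrank ℂ E)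
    (hell : Fintype.card ρ = 1 → ∀ ν, finrank ℂ (G ν) = 1) :
    finrank ℤ (neronSeveriGroup A) = (finrank ℂ E - 1) ^ 2 + 1 ↔
      Fintype.card ρ = 2 ∧ ∃ ν₀, (∀ ν, finrank ℂ (G ν) = 1) ∧ (∀ ν, ν ≠ ν₀ → n ν = 1) ∧
        finrank ℚ (endAlgRat (X ν₀)) = 2 := by
  have hcard_le := hiso.card_le_finrank_of_powers X n hn
  constructor
  · intro h
    -- `r(A) = 2`
    have h2 : Fintype.card ρ = 2 := by
      rcases Nat.lt_or_ge (Fintype.card ρ) 3 with hr | hr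
      · rcases Nat.lt_or_ge (Fintype.card ρ) 2 with hr1 | hr2
        · exfalso
          have h1 : Fintype.card ρ = 1 := le_antisymm (by omega) Fintype.card_pos
          rcases hiso.finrank_neronSeveriGroup_eq_sq_or_eq_choose_of_card_eq_one X n h1 (hell h1) with h' | h'
          · rw [h'] at h
            obtain ⟨c, hc⟩ : ∃ c, finrank ℂ E = c + 5 := ⟨finrank ℂ E - 5, by omega⟩
            rw [hc, show c + 5 - 1 = c + 4 by omega] at h
            nlinarith
          · rw [h'] at h
            have := choose_succ_two_lt_sq_pred_add_one hg
            omega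
        · omega
      · exfalso
        have := hiso.finrank_neronSeveriGroup_le_sq_sub_two_add_two_of_three_le_card X n hX hA hXX hn hr
        have h4 := sq_sub_two_add_four_lt_sq_pred_add_one (g := finrank ℂ E) (by omega)
        omega
    refine ⟨h2, ?_⟩
    have key := (hiso.finrank_neronSeveriGroup_eq_iff_of_powers X n hX hA hXX hn).1 (by rw [h, h2])
    obtain ⟨ν₀, hd, hn1, hcm⟩ := key
    refine ⟨ν₀, hd, hn1, hcm ?_⟩
    -- `n_{ν₀} = g − 1 ≥ 2`
    obtain ⟨x, y, hxy, -, hgab, -⟩ := hiso.exists_two_factors_of_card_eq_two X n hX hA hXX h2 hd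
    by_cases hx : x = ν₀
    · subst hx
      have := hn1 y (Ne.symm hxy)
      omega
    · have := hn1 x hx
      by_cases hy : y = ν₀
      · subst hy
        omega
      · have := hn1 y hy
        omega
  · rintro ⟨h2, ν₀, hd, hn1, hcm⟩
    rw [(hiso.finrank_neronSeveriGroup_eq_iff_of_powers X n hX hA hXX hn).2 ⟨ν₀, hd, hn1, fun _ ↦ hcm⟩, h2]

/-- **Hulek–Laface 2019, Thm. 4.2 (2), for every abelian variety of dimension `g ≥ 7` whose Poincaré
decomposition, when of length `≤ 2`, consists of elliptic curves:** `ρ(A) = (g−2)² + 4` iff the Poincaré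
decomposition has length `2`, both factors are elliptic curves with complex multiplication, and one
exponent is `2` (so the other is `g − 2`) ("`ρ(A) = (g−2)² + 4 ⟺ A ∼ E_1^{g−2} × E_2²`, where `E_1` and
`E_2` both have complex multiplication but are not isogeneous"). Proof as printed: `r(A) ≤ 2` by `M_{3,g}`,
`r(A) ≠ 1` (`g²`, `C(g+1,2) ≠ (g−2)² + 4`), and case (c) `A ∼ E_1^n × E_2^{g−n}`:
`eq_sq_of_add_eq_sq_sub_two_add_four`.
-- TODO(general form): cases (a) `Aᵏ × Bˡ`, (b) `Eᵏ × Bˡ` (`dim > 1`) and `r(A) = 1`, `dim B ≥ 2` need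
-- Murty's Cor. 2.5.
[cite: HulekLaface2019PicardNumbersAV, §4 Thm. 4.2 (2)] -/
theorem IsIsogenous.finrank_neronSeveriGroup_eq_sq_sub_two_add_four_iff_of_powers [Nonempty ρ]
    {A : (ι → ℝ) ≃L[ℝ] E} (hiso : IsIsogenous A (sigmaPiPeriod fun ν ↦ powPeriod (X ν) (n ν)))
    (hX : ∀ ν, IsSimple (X ν)) (hA : ∀ ν, IsAbelianVariety (X ν))
    (hXX : ∀ ν ν', ν ≠ ν' → ¬ IsIsogenous (X ν) (X ν')) (hn : ∀ ν, 0 < n ν) (hg : 7 ≤ finrank ℂ E)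
    (hell : Fintype.card ρ ≤ 2 → ∀ ν, finrank ℂ (G ν) = 1) :
    finrank ℤ (neronSeveriGroup A) = (finrank ℂ E - 2) ^ 2 + 4 ↔
      Fintype.card ρ = 2 ∧ (∀ ν, finrank ℂ (G ν) = 1) ∧ (∀ ν, finrank ℚ (endAlgRat (X ν)) = 2) ∧
        ∃ ν, n ν = 2 := by
  constructor
  · intro h
    have h2 : Fintype.card ρ = 2 := by
      rcases Nat.lt_or_ge (Fintype.card ρ) 3 with hr | hr
      · rcases Nat.lt_or_ge (Fintype.card ρ) 2 with hr1 | hr2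
        · exfalso
          have h1 : Fintype.card ρ = 1 := le_antisymm (by omega) Fintype.card_pos
          rcases hiso.finrank_neronSeveriGroup_eq_sq_or_eq_choose_of_card_eq_one X n h1 (hell (by omega))
            with h' | h'
          · rw [h'] at h
            obtain ⟨c, hc⟩ : ∃ c, finrank ℂ E = c + 7 := ⟨finrank ℂ E - 7, by omega⟩
            rw [hc, show c + 7 - 2 = c + 5 by omega] at h
            nlinarith
          · rw [h'] at h
            have := choose_succ_two_lt_sq_sub_two_add_four hg
            omega
        · omega
      · exfalso
        have := hiso.finrank_neronSeveriGroup_le_sq_sub_two_add_two_of_three_le_card X n hX hA hXX hn hr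
        omega
    have hd := hell h2.le
    obtain ⟨x, y, hxy, hu, hgab, hρ⟩ := hiso.exists_two_factors_of_card_eq_two X n hX hA hXX h2 hd
    rw [hρ, hgab] at h
    rw [hgab] at hg
    obtain ⟨hx2, hy2, hpx, hqy, h22⟩ := eq_sq_of_add_eq_sq_sub_two_add_four (hn x) (hn y) hg
      (finrank_neronSeveriGroup_pow_eq_sq_or_eq_choose (X x) (hd x) (n x))
      (finrank_neronSeveriGroup_pow_eq_sq_or_eq_choose (X y) (hd y) (n y)) h
    have hcmx := finrank_endAlgRat_eq_two_of_pow_eq_sq (X x) (hd x) hx2 hpx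
    have hcmy := finrank_endAlgRat_eq_two_of_pow_eq_sq (X y) (hd y) hy2 hqy
    refine ⟨h2, hd, fun ν ↦ ?_, ?_⟩
    · have hν := Finset.mem_univ ν
      rw [hu, Finset.mem_insert, Finset.mem_singleton] at hν
      rcases hν with rfl | rfl
      · exact hcmx
      · exact hcmy
    · rcases h22 with h' | h'
      · exact ⟨x, h'⟩
      · exact ⟨y, h'⟩
  · rintro ⟨h2, hd, hcm, ν₁, hν₁⟩
    obtain ⟨x, y, hxy, hu, hgab, hρ⟩ := hiso.exists_two_factors_of_card_eq_two X n hX hA hXX h2 hd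
    rw [hρ, hgab, finrank_neronSeveriGroup_pow_of_cm (X x) (hd x) (hcm x),
      finrank_neronSeveriGroup_pow_of_cm (X y) (hd y) (hcm y)]
    have hν : ν₁ = x ∨ ν₁ = y := by
      have h := Finset.mem_univ ν₁
      rw [hu, Finset.mem_insert, Finset.mem_singleton] at h
      exact h
    rcases hν with rfl | rfl
    · rw [hν₁, show 2 + n y - 2 = n y by omega]
      ring
    · rw [hν₁, show n x + 2 - 2 = n x by omega]
      ring

end Structure

end ComplexTorus

end Literature.Geometry.Kaehler

end
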